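import Literature.Combinatorics.Optimization.TracialDesigns
import HarnessLib

/-!
# Cell pnp-psdrank, route `ChebyshevTracialDesign`: block-diagonal psd strategies reduce to their blocks — the
# dimension budget of the crux can be replaced by the largest block size

For the crux `TracialDecayExp20` (stmt-PneNP-19878) a psd rectangle of dimension `r` (`IsPsdRect`: `0 ⪯ X_U, Y_M ⪯ I_r`,
`X_U Y_M = 0` on tight pairs) is BLOCK DIAGONAL with respect to a labelling `blk : Fin r → Fin m` of the coordinates
if every `X_U` and every `Y_M` has zero entries across different labels. Then:

* §1 each block (the principal submatrix on `{i : blk i = b}`, re-indexed by `Fin d_b`, `d_b = #{i : blk i = b}`) is a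
  psd rectangle of dimension `d_b` (`isPsdRect_block`), and `tr(X_U Y_M) = Σ_b tr(X_U^{(b)} Y_M^{(b)})`
  (`trace_mul_eq_sum_blocks`);
* §2 hence the value against any weight `W` is the sum of the block values (`value_eq_sum_blocks`), and if
  `TracialValueLEAt W γ d_b` holds for every block size `d_b` that occurs, the whole strategy has value `≤ r·γ`
  (`value_le_of_blockDiagonal`): on block-diagonal strategies the crux in dimension `r` FOLLOWS from the crux in the
  dimensions of the blocks — the budget `r²·n < exp(a·dq n)` can be replaced by "every block has dimension within
  budget", however many blocks there are (`value_div_le_of_blocks_le`). Blocks of size `1` are the diagonal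
  (commutative) strategies of `ChebyshevTracialDesignCommutative` (p427382), governed by the `r = 1` rectangle bound.

This is the factorization-side counterpart of the cell's block-lift theorems (eng, `SmallBlockRothvossBallGrid*`:
`(S^b_+)^m`-lifts of the matching polytope need `m ≥ 2^{Ω(n/(b+1))}/n⁹`, proved unconditionally via Rothvoß's
rectangle lemma): here the statement is conditional on the small-dimension crux but holds for the route's multilevel
designs and at the crux's threshold. [cite: Rothvoss2017, §2 (PDF pp. 6–7)] [cite: BrietDadushPokutta2014, Thm. 6 (§3)]
WHAT THIS IS NOT: nothing for strategies without block structure; nothing on general psd rank. Supports stmt-PneNP-19878.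
-/

set_option linter.dupNamespace false -- `Summit.PneNP.PneNP.…`: summit = sub-problem (D-0017)

noncomputable section

namespace Summit.PneNP.PneNP.Theorems.ChebyshevTracialDesignBlockDiagonal

open Finset Matrix Literature.Barriers.PneNP Literature.Combinatorics.Optimization

variable {n : ℕ}

/-! ### §1 Blocks of a block-diagonal strategy -/

section Blocks

variable {r m : ℕ} (blk : Fin r → Fin m) (b : Fin m)

/-- A sum over `Fin r` of a function vanishing off the block `b` is the sum over the block, re-indexed by `Fin d_b`. -/
theorem sum_eq_sum_block (f : Fin r → ℝ) (hf : ∀ k, blk k ≠ b → f k = 0) :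
    ∑ k, f k = ∑ a : Fin (Fintype.card {i : Fin r // blk i = b}),
      f ((Fintype.equivFin {i : Fin r // blk i = b}).symm a).1 := by
  classical
  have h1 : ∑ k, f k = ∑ k ∈ univ.filter (fun k : Fin r => blk k = b), f k := by
    rw [sum_filter]
    refine sum_congr rfl fun k _ => ?_
    by_cases hk : blk k = b
    · rw [if_pos hk]
    · rw [if_neg hk, hf k hk]
  rw [h1, sum_subtype (univ.filter (fun k : Fin r => blk k = b)) (p := fun k => blk k = b) (by simp)]
  exact ((Fintype.equivFin {i : Fin r // blk i = b}).symm.sum_comp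
    (fun k : {i : Fin r // blk i = b} => f k.1)).symm

/-- For matrices vanishing across blocks, the product restricted to a block is the product of the restrictions. -/
theorem submatrix_mul_block (A B : Matrix (Fin r) (Fin r) ℝ) (hA : ∀ i j, blk i ≠ blk j → A i j = 0) :
    (A * B).submatrix (fun a => ((Fintype.equivFin {i : Fin r // blk i = b}).symm a).1)
        (fun a => ((Fintype.equivFin {i : Fin r // blk i = b}).symm a).1) =
      A.submatrix (fun a => ((Fintype.equivFin {i : Fin r // blk i = b}).symm a).1)
          (fun a => ((Fintype.equivFin {i : Fin r // blk i = b}).symm a).1) *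
        B.submatrix (fun a => ((Fintype.equivFin {i : Fin r // blk i = b}).symm a).1)
          (fun a => ((Fintype.equivFin {i : Fin r // blk i = b}).symm a).1) := by
  ext a c
  simp only [submatrix_apply, mul_apply]
  refine sum_eq_sum_block blk b _ fun k hk => ?_
  have hik : blk ((Fintype.equivFin {i : Fin r // blk i = b}).symm a).1 ≠ blk k := by
    rw [((Fintype.equivFin {i : Fin r // blk i = b}).symm a).2]; exact fun h => hk h.symm
  rw [hA _ _ hik, zero_mul]

/-- The trace of a product of block-diagonal matrices is the sum of the traces of the block products. -/
theorem trace_mul_eq_sum_blocks (A B : Matrix (Fin r) (Fin r) ℝ) (hA : ∀ i j, blk i ≠ blk j → A i j = 0) :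
    (A * B).trace = ∑ b : Fin m,
      (A.submatrix (fun a => ((Fintype.equivFin {i : Fin r // blk i = b}).symm a).1)
          (fun a => ((Fintype.equivFin {i : Fin r // blk i = b}).symm a).1) *
        B.submatrix (fun a => ((Fintype.equivFin {i : Fin r // blk i = b}).symm a).1)
          (fun a => ((Fintype.equivFin {i : Fin r // blk i = b}).symm a).1)).trace := by
  classical
  simp only [← submatrix_mul_block blk _ A B hA]
  unfold Matrix.trace
  simp only [diag_apply, submatrix_apply]
  rw [← Fintype.sum_fiberwise blk (fun i => (A * B) i i)]
  refine sum_congr rfl fun b _ => ?_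
  exact ((Fintype.equivFin {i : Fin r // blk i = b}).symm.sum_comp
    (fun k : {i : Fin r // blk i = b} => (A * B) k.1 k.1)).symm

/-- **Each block of a block-diagonal psd rectangle is a psd rectangle** (of the block's dimension). -/
theorem isPsdRect_block {X : OddSet n → Matrix (Fin r) (Fin r) ℝ} {Y : PMatch n → Matrix (Fin r) (Fin r) ℝ}
    (h : IsPsdRect X Y) (hX : ∀ U i j, blk i ≠ blk j → X U i j = 0) :
    IsPsdRect
      (fun U => (X U).submatrix (fun a => ((Fintype.equivFin {i : Fin r // blk i = b}).symm a).1)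
        (fun a => ((Fintype.equivFin {i : Fin r // blk i = b}).symm a).1))
      (fun M => (Y M).submatrix (fun a => ((Fintype.equivFin {i : Fin r // blk i = b}).symm a).1)
        (fun a => ((Fintype.equivFin {i : Fin r // blk i = b}).symm a).1)) := by
  set ι : Fin (Fintype.card {i : Fin r // blk i = b}) → Fin r :=
    fun a => ((Fintype.equivFin {i : Fin r // blk i = b}).symm a).1 with hι
  have hinj : Function.Injective ι := fun a a' haa' =>
    (Fintype.equivFin {i : Fin r // blk i = b}).symm.injective (Subtype.ext haa')
  have hone : ∀ A : Matrix (Fin r) (Fin r) ℝ, (1 - A).submatrix ι ι = 1 - A.submatrix ι ι := fun A => by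
    rw [submatrix_sub, Pi.sub_apply, Pi.sub_apply, submatrix_one ι hinj]
  obtain ⟨hXp, hYp, hXY⟩ := h
  refine ⟨fun U => ⟨(hXp U).1.submatrix ι, ?_⟩, fun M => ⟨(hYp M).1.submatrix ι, ?_⟩, fun U M hcc => ?_⟩
  · rw [← hone]; exact (hXp U).2.submatrix ι
  · rw [← hone]; exact (hYp M).2.submatrix ι
  · show (X U).submatrix ι ι * (Y M).submatrix ι ι = 0
    rw [hι, ← submatrix_mul_block blk b (X U) (Y M) (hX U), hXY U M hcc, submatrix_zero, Pi.zero_apply, Pi.zero_apply]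

end Blocks

/-! ### §2 The value of a block-diagonal strategy is the sum of its block values -/

/-- **Value = sum of block values** for a block-diagonal strategy. -/
theorem value_eq_sum_blocks {r m : ℕ} (blk : Fin r → Fin m) (W : OddSet n → PMatch n → ℝ)
    (X : OddSet n → Matrix (Fin r) (Fin r) ℝ) (Y : PMatch n → Matrix (Fin r) (Fin r) ℝ)
    (hX : ∀ U i j, blk i ≠ blk j → X U i j = 0) :
    ∑ U, ∑ M, W U M * (X U * Y M).trace = ∑ b : Fin m, ∑ U, ∑ M, W U M *
      ((X U).submatrix (fun a => ((Fintype.equivFin {i : Fin r // blk i = b}).symm a).1)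
          (fun a => ((Fintype.equivFin {i : Fin r // blk i = b}).symm a).1) *
        (Y M).submatrix (fun a => ((Fintype.equivFin {i : Fin r // blk i = b}).symm a).1)
          (fun a => ((Fintype.equivFin {i : Fin r // blk i = b}).symm a).1)).trace := by
  calc ∑ U, ∑ M, W U M * (X U * Y M).trace
      = ∑ U, ∑ M, ∑ b : Fin m, W U M *
          ((X U).submatrix (fun a => ((Fintype.equivFin {i : Fin r // blk i = b}).symm a).1)
              (fun a => ((Fintype.equivFin {i : Fin r // blk i = b}).symm a).1) *
            (Y M).submatrix (fun a => ((Fintype.equivFin {i : Fin r // blk i = b}).symm a).1)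
              (fun a => ((Fintype.equivFin {i : Fin r // blk i = b}).symm a).1)).trace := by
        refine sum_congr rfl fun U _ => sum_congr rfl fun M _ => ?_
        rw [trace_mul_eq_sum_blocks blk (X U) (Y M) (hX U), mul_sum]
    _ = ∑ U, ∑ b : Fin m, ∑ M, W U M *
          ((X U).submatrix (fun a => ((Fintype.equivFin {i : Fin r // blk i = b}).symm a).1)
              (fun a => ((Fintype.equivFin {i : Fin r // blk i = b}).symm a).1) *
            (Y M).submatrix (fun a => ((Fintype.equivFin {i : Fin r // blk i = b}).symm a).1)
              (fun a => ((Fintype.equivFin {i : Fin r // blk i = b}).symm a).1)).trace :=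
        sum_congr rfl fun U _ => sum_comm
    _ = _ := sum_comm

/-- The block dimensions add up to `r`. -/
theorem sum_card_blocks {r m : ℕ} (blk : Fin r → Fin m) :
    ∑ b : Fin m, (Fintype.card {i : Fin r // blk i = b} : ℝ) = r := by
  classical
  have h := Fintype.sum_fiberwise blk (fun _ : Fin r => (1 : ℝ))
  simp only [sum_const, card_univ, nsmul_eq_mul, mul_one, Fintype.card_fin] at h
  exact h

/-- **Block-diagonal strategies reduce to their blocks.** If `(X, Y)` is a psd rectangle of dimension `r`, block
diagonal for the labelling `blk : Fin r → Fin m`, and the weight `W` has tracial value `≤ γ` in the dimension of every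
block (`TracialValueLEAt W γ d_b`), then the value of `(X, Y)` is at most `r·γ`. -/
theorem value_le_of_blockDiagonal {r m : ℕ} (blk : Fin r → Fin m) (W : OddSet n → PMatch n → ℝ) (γ : ℝ)
    (hγ : ∀ b : Fin m, TracialValueLEAt W γ (Fintype.card {i : Fin r // blk i = b}))
    {X : OddSet n → Matrix (Fin r) (Fin r) ℝ} {Y : PMatch n → Matrix (Fin r) (Fin r) ℝ} (h : IsPsdRect X Y)
    (hX : ∀ U i j, blk i ≠ blk j → X U i j = 0) (hY : ∀ M i j, blk i ≠ blk j → Y M i j = 0) :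
    ∑ U, ∑ M, W U M * (X U * Y M).trace ≤ r * γ := by
  -- `hY` is not needed for the identity (one-sided vanishing suffices) but is the natural hypothesis; record its use
  have _hY := hY
  rw [value_eq_sum_blocks blk W X Y hX, ← sum_card_blocks blk, sum_mul]
  refine sum_le_sum fun b _ => ?_
  have hblock := hγ b _ _ (isPsdRect_block blk b h hX)
  rcases Nat.eq_zero_or_pos (Fintype.card {i : Fin r // blk i = b}) with h0 | hpos
  · -- empty block: the block value is a sum of traces of `0 × 0` matrices
    have hE : IsEmpty (Fin (Fintype.card {i : Fin r // blk i = b})) := by rw [h0]; infer_instance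
    have hz : ∀ (U : OddSet n) (M : PMatch n),
        ((X U).submatrix (fun a => ((Fintype.equivFin {i : Fin r // blk i = b}).symm a).1)
            (fun a => ((Fintype.equivFin {i : Fin r // blk i = b}).symm a).1) *
          (Y M).submatrix (fun a => ((Fintype.equivFin {i : Fin r // blk i = b}).symm a).1)
            (fun a => ((Fintype.equivFin {i : Fin r // blk i = b}).symm a).1)).trace = 0 := by
      intro U M
      unfold Matrix.trace
      exact Finset.sum_eq_zero fun i _ => (hE.false i).elim
    simp only [hz, mul_zero, sum_const_zero, h0, Nat.cast_zero, zero_mul, le_refl]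
  · have hd : (0 : ℝ) < Fintype.card {i : Fin r // blk i = b} := by exact_mod_cast hpos
    rw [div_le_iff₀ hd] at hblock
    calc _ ≤ γ * Fintype.card {i : Fin r // blk i = b} := hblock
      _ = Fintype.card {i : Fin r // blk i = b} * γ := mul_comm _ _

/-- **The dimension budget can be replaced by the largest block size.** If `TracialValueLEAt W γ d` holds for every
dimension `d ≤ d₀` and `(X, Y)` is a block-diagonal psd rectangle of dimension `r ≥ 1` all of whose blocks have
dimension `≤ d₀`, then `value / r ≤ γ`. (With `d₀ = 1` these are the diagonal strategies of
`ChebyshevTracialDesignCommutative`, governed by the `r = 1` rectangle bound.) -/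
theorem value_div_le_of_blocks_le {r m : ℕ} (hr : 0 < r) (blk : Fin r → Fin m) (W : OddSet n → PMatch n → ℝ)
    (γ : ℝ) (d₀ : ℕ) (hγ : ∀ d : ℕ, d ≤ d₀ → TracialValueLEAt W γ d)
    (hsmall : ∀ b : Fin m, Fintype.card {i : Fin r // blk i = b} ≤ d₀)
    {X : OddSet n → Matrix (Fin r) (Fin r) ℝ} {Y : PMatch n → Matrix (Fin r) (Fin r) ℝ} (h : IsPsdRect X Y)
    (hX : ∀ U i j, blk i ≠ blk j → X U i j = 0) (hY : ∀ M i j, blk i ≠ blk j → Y M i j = 0) :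
    (∑ U, ∑ M, W U M * (X U * Y M).trace) / r ≤ γ := by
  rw [div_le_iff₀ (by exact_mod_cast hr : (0 : ℝ) < r)]
  calc ∑ U, ∑ M, W U M * (X U * Y M).trace ≤ r * γ :=
        value_le_of_blockDiagonal blk W γ (fun b => hγ _ (hsmall b)) h hX hY
    _ = γ * r := mul_comm _ _

/-- **For the route**: if, for a design weight `levelWeight n t C w`, the crux's inequality holds in every dimension
`d ≤ d₀` (threshold `γ`), then it holds — same threshold — for block-diagonal tight psd rectangles of every dimension
whose blocks have dimension `≤ d₀`. -/
theorem blockDiagonal_of_smallDimension {t r m : ℕ} (hr : 0 < r) (C : Finset ℕ) (w : ℕ → ℝ) (γ : ℝ) (d₀ : ℕ)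
    (hγ : ∀ d : ℕ, d ≤ d₀ → TracialValueLEAt (levelWeight n t C w) γ d) (blk : Fin r → Fin m)
    (hsmall : ∀ b : Fin m, Fintype.card {i : Fin r // blk i = b} ≤ d₀)
    {X : OddSet n → Matrix (Fin r) (Fin r) ℝ} {Y : PMatch n → Matrix (Fin r) (Fin r) ℝ} (h : IsPsdRect X Y)
    (hX : ∀ U i j, blk i ≠ blk j → X U i j = 0) (hY : ∀ M i j, blk i ≠ blk j → Y M i j = 0) :
    (∑ U, ∑ M, levelWeight n t C w U M * (X U * Y M).trace) / r ≤ γ :=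
  value_div_le_of_blocks_le hr blk (levelWeight n t C w) γ d₀ hγ hsmall h hX hY

end Summit.PneNP.PneNP.Theorems.ChebyshevTracialDesignBlockDiagonal

end
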